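import Summits.AtomisticToContinuum.HydrodynamicLimit.Theorems.JParityClosureParityBandClosureWindowCovarianceIsotropyH
import HarnessLib

/-!
# Window covariance isotropy (crux `JParityClosure.ParityBandClosure`, stmt-AtomisticToContinuum-17608, line
# `transfer-weighted-parity-chain`, stub `stub_windowCovarianceIsotropy`) — helper I: the deviator algebra of the window
# covariance

WHAT.  With the dictionary of helper F (`E_w`, `m_w`, `ρ_w` = second / first moments / mass of the window law
`λ_w`): §1 for ANY window, `C_w = ρ_w Cov(ν_w)` is a covariance, so `|C_{jk}| ≤ (C_{jj} + C_{kk})/2`, `C_{jj} ≤ E_{jj}`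
and the `ℓ¹` deviator is at most `4 tr C_w ≤ 4 ∫‖v‖² dλ_w` (`devW_le_four_mul`); §2 on a GOOD window — the conclusion of
`ParityStability` for the normalised law `ν_w`: `|∫v_j dν_w − u_j| ≤ ε`, `|∫(v_j−u_j)(v_k−u_k)dν_w − θδ_{jk}| ≤ ε` —
the deviator is at most `18 ρ_w (ε + ε²)` (`devW_le_of_isotropic`): the covariance differs from the `u`-centred
second moments by `(v̄ − u) ⊗ (v̄ − u)`.

REFERENCES.  Elementary (covariance algebra); S. Chapman, T. G. Cowling (1970) §2.3 (pressure tensor as a covariance).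
No named fact is invoked.
-/

noncomputable section

namespace Summit.AtomisticToContinuum.HydrodynamicLimit.Theorems.ParityBandClosureWindowCovariance

open scoped BigOperators Topology Classical MeasureTheory ENNReal InnerProductSpace
open Filter Set MeasureTheory Function Topology
open Literature.MathematicalPhysics.KineticTheory
open Literature.Analysis.FluidPDE
open Summit.AtomisticToContinuum.HydrodynamicLimit.Theorems.LocalSecondLawNegative (cone cone_nonneg cone_le
  continuous_cone integral_cone_le)

variable {N : ℕ}

/-! ## §0 The `ℓ¹` deviator of a `3 × 3` array against entrywise bounds -/

/-- If `|C_{jk}| ≤ (d_j + d_k)/2` for `j ≠ k`, `|C_{jj} − t/3| ≤ d_j + t/3` with `t = Σ d_l ≥ 0`, then the `ℓ¹` deviator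
is at most `4t`. [folklore] -/
theorem dev_le_four_trace (C : Fin 3 → Fin 3 → ℝ) (d : Fin 3 → ℝ) (_hd : ∀ j, 0 ≤ d j)
    (hoff : ∀ j k, j ≠ k → |C j k| ≤ (d j + d k) / 2) (hdiag : ∀ j, |C j j - (∑ l, d l) / 3| ≤ d j + (∑ l, d l) / 3)
    (htr : ∑ l, C l l = ∑ l, d l) :
    ∑ j, ∑ k, |C j k - if j = k then (∑ l, C l l) / 3 else 0| ≤ 4 * ∑ l, d l := by
  rw [htr]
  have hb : ∀ j k, |C j k - if j = k then (∑ l, d l) / 3 else 0| ≤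
      if j = k then d j + (∑ l, d l) / 3 else (d j + d k) / 2 := by
    intro j k
    by_cases hjk : j = k
    · subst hjk; simp only [if_true]; exact hdiag j
    · simp only [hjk, if_false, sub_zero]; exact hoff j k hjk
  calc ∑ j, ∑ k, |C j k - if j = k then (∑ l, d l) / 3 else 0|
      ≤ ∑ j, ∑ k, (if j = k then d j + (∑ l, d l) / 3 else (d j + d k) / 2 : ℝ) :=
        Finset.sum_le_sum fun j _ => Finset.sum_le_sum fun k _ => hb j k
    _ = 4 * ∑ l, d l := by
        have h01 : ((0 : Fin 3) = 1) ↔ False := by decide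
        have h02 : ((0 : Fin 3) = 2) ↔ False := by decide
        have h10 : ((1 : Fin 3) = 0) ↔ False := by decide
        have h12 : ((1 : Fin 3) = 2) ↔ False := by decide
        have h20 : ((2 : Fin 3) = 0) ↔ False := by decide
        have h21 : ((2 : Fin 3) = 1) ↔ False := by decide
        simp only [Fin.sum_univ_three, Fin.isValue, h01, h02, h10, h12, h20, h21, if_false, if_true]
        ring

/-! ## §1 Any window: the deviator against the second moment -/

section Any

variable {r τ t₀ : ℝ} {x₀ : T3} {γ : ℝ → Config (N + 1) (Fin 3) T3}

/-- **The deviator of the window covariance is at most `4 ∫‖v‖² dλ_w`** (any window; `λ_w` carried by velocities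
`≤ R`). [folklore] -/
theorem devW_le_four_mul (hr : 0 < r) (hγ : Measurable γ) {R : ℝ} (hR : ∀ s k, ‖(γ s k).2‖ ≤ R) :
    devW r τ γ t₀ x₀ ≤ 4 * ∫ v, ‖v‖ ^ 2 ∂(wlaw r τ t₀ x₀ γ) := by
  haveI := isFiniteMeasure_wlaw (N := N) (τ := τ) (t₀ := t₀) (x₀ := x₀) (γ := γ) hr
  set μ := wlaw r τ t₀ x₀ γ with hμ
  have hR0 : 0 ≤ R := (norm_nonneg _).trans (hR 0 0)
  have hc : ∀ (v : V3) (i : Fin 3), |v i| ≤ ‖v‖ := fun v i => by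
    rw [← Real.norm_eq_abs]; exact PiLp.norm_apply_le v i
  -- integrability of coordinates and their products
  have hi1 : ∀ j, Integrable (fun v : V3 => v j) μ := fun j =>
    integrable_wlaw hr hγ hR (measurable_coordV3 j) fun v hv => (hc v j).trans hv
  have hi2 : ∀ j k, Integrable (fun v : V3 => v j * v k) μ := fun j k =>
    integrable_wlaw hr hγ hR ((measurable_coordV3 j).mul (measurable_coordV3 k)) fun v hv => by
      rw [abs_mul]; exact mul_le_mul ((hc v j).trans hv) ((hc v k).trans hv) (abs_nonneg _) ((norm_nonneg _).trans hv)
  -- the dictionary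
  set ρ := rhoW r τ γ t₀ x₀ with hρ
  have hρm : ρ = μ.real Set.univ := by rw [hρ, rhoW_eq_mass hr hγ, measureReal_def]
  have hm : ∀ j, mwW r τ γ t₀ x₀ j = ∫ v, v j ∂μ := fun j => mwW_eq_integral hr hγ hR j
  have hE : ∀ j k, EwW r τ γ t₀ x₀ j k = ∫ v, v j * v k ∂μ := fun j k => EwW_eq_integral hr hγ hR j k
  -- centred form of `C_w`
  set a : Fin 3 → ℝ := fun j => (∫ v, v j ∂μ) / ρ with ha
  have hC : ∀ j k, CwW r τ γ t₀ x₀ j k = ∫ v, (v j - a j) * (v k - a k) ∂μ := by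
    intro j k
    have hexp : (fun v : V3 => (v j - a j) * (v k - a k)) =
        fun v => v j * v k - a k * v j - a j * v k + a j * a k := by funext v; ring
    have i1 : Integrable (fun v : V3 => v j * v k - a k * v j) μ := (hi2 j k).sub ((hi1 j).const_mul _)
    have i2 : Integrable (fun v : V3 => v j * v k - a k * v j - a j * v k) μ := i1.sub ((hi1 k).const_mul _)
    rw [hexp, integral_add i2 (integrable_const _), integral_sub i1 ((hi1 k).const_mul _),
      integral_sub (hi2 j k) ((hi1 j).const_mul _), integral_const_mul, integral_const_mul, integral_const,
      smul_eq_mul, ← hρm]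
    unfold CwW
    rw [hE, hm, hm, ← hρ, ha]
    by_cases hρ0 : ρ = 0
    · -- empty window: everything vanishes
      have hμ0 : μ = 0 := by
        rw [← Measure.measure_univ_eq_zero]
        have h1 : (μ Set.univ).toReal = 0 := by rw [← measureReal_def, ← hρm, hρ0]
        exact (ENNReal.toReal_eq_zero_iff _ |>.1 h1).resolve_right (measure_ne_top _ _)
      simp [hμ0]
    · field_simp
      ring
  -- entrywise bounds
  have hdiag0 : ∀ j, 0 ≤ CwW r τ γ t₀ x₀ j j := fun j => by
    rw [hC]; exact integral_nonneg fun v => mul_self_nonneg _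
  have hoff : ∀ j k, j ≠ k → |CwW r τ γ t₀ x₀ j k| ≤ (CwW r τ γ t₀ x₀ j j + CwW r τ γ t₀ x₀ k k) / 2 := by
    intro j k _
    rw [hC, hC, hC]
    have hij : Integrable (fun v : V3 => (v j - a j) * (v j - a j)) μ := ((hi1 j).sub (integrable_const _)).mul_of_top_left
      (memLp_top_of_bound (((measurable_coordV3 j).sub measurable_const).aestronglyMeasurable) (R + |a j|)
        (by filter_upwards [ae_wlaw_norm_le (r := r) (τ := τ) (t₀ := t₀) (x₀ := x₀) hγ hR] with v hv
            rw [Real.norm_eq_abs]; exact (abs_sub _ _).trans (add_le_add ((hc v j).trans hv) le_rfl)))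
    have hik : Integrable (fun v : V3 => (v k - a k) * (v k - a k)) μ := ((hi1 k).sub (integrable_const _)).mul_of_top_left
      (memLp_top_of_bound (((measurable_coordV3 k).sub measurable_const).aestronglyMeasurable) (R + |a k|)
        (by filter_upwards [ae_wlaw_norm_le (r := r) (τ := τ) (t₀ := t₀) (x₀ := x₀) hγ hR] with v hv
            rw [Real.norm_eq_abs]; exact (abs_sub _ _).trans (add_le_add ((hc v k).trans hv) le_rfl)))
    calc |∫ v, (v j - a j) * (v k - a k) ∂μ| ≤ ∫ v, |(v j - a j) * (v k - a k)| ∂μ := abs_integral_le_integral_abs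
      _ ≤ ∫ v, ((v j - a j) * (v j - a j) + (v k - a k) * (v k - a k)) / 2 ∂μ := by
          refine integral_mono_of_nonneg (Eventually.of_forall fun v => abs_nonneg _) ((hij.add hik).div_const 2)
            (Eventually.of_forall fun v => ?_)
          dsimp only
          rw [abs_mul]
          nlinarith [sq_nonneg (|v j - a j| - |v k - a k|), sq_abs (v j - a j), sq_abs (v k - a k)]
      _ = _ := by rw [integral_div, integral_add hij hik]
  have htr : ∑ l, CwW r τ γ t₀ x₀ l l ≤ ∫ v, ‖v‖ ^ 2 ∂μ := by
    have hle : ∀ l, CwW r τ γ t₀ x₀ l l ≤ ∫ v, v l * v l ∂μ := by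
      intro l
      unfold CwW
      rw [hE]
      have : 0 ≤ mwW r τ γ t₀ x₀ l * mwW r τ γ t₀ x₀ l / rhoW r τ γ t₀ x₀ :=
        div_nonneg (mul_self_nonneg _) (rhoW_nonneg hr hγ)
      linarith
    calc ∑ l, CwW r τ γ t₀ x₀ l l ≤ ∑ l, ∫ v, v l * v l ∂μ := Finset.sum_le_sum fun l _ => hle l
      _ = ∫ v, ∑ l, v l * v l ∂μ := (integral_finsetSum _ fun l _ => hi2 l l).symm
      _ = ∫ v, ‖v‖ ^ 2 ∂μ := integral_congr_ae (Eventually.of_forall fun v => by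
          show ∑ l, v l * v l = ‖v‖ ^ 2
          rw [EuclideanSpace.norm_sq_eq]
          exact Finset.sum_congr rfl fun l _ => by rw [Real.norm_eq_abs, sq_abs]; ring)
  have hdev := dev_le_four_trace (CwW r τ γ t₀ x₀) (fun j => CwW r τ γ t₀ x₀ j j) hdiag0 hoff (fun j => by
    have h0 := hdiag0 j
    have hs : 0 ≤ ∑ l, CwW r τ γ t₀ x₀ l l := Finset.sum_nonneg fun l _ => hdiag0 l
    rw [abs_le]; constructor <;> linarith) rfl
  unfold devW
  linarith

end Any

/-! ## §2 Good windows: the deviator after `ParityStability` -/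

section Good

variable {r τ t₀ : ℝ} {x₀ : T3} {γ : ℝ → Config (N + 1) (Fin 3) T3}

/-- **On a window whose normalised law has `ε`-isotropic `u`-centred second moments, the deviator of the window
covariance is at most `18 ρ_w (ε + ε²)`.** [folklore] -/
theorem devW_le_of_isotropic (hr : 0 < r) (hγ : Measurable γ) {R : ℝ} (hR : ∀ s k, ‖(γ s k).2‖ ≤ R)
    (hρ0 : 0 < rhoW r τ γ t₀ x₀) {ε θ : ℝ} (hε : 0 ≤ ε) (u : V3)
    (h1 : ∀ j : Fin 3, |(∫ v, v j ∂((ENNReal.ofReal (rhoW r τ γ t₀ x₀))⁻¹ • wlaw r τ t₀ x₀ γ)) - u j| ≤ ε)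
    (h2 : ∀ j k : Fin 3, |(∫ v, (v j - u j) * (v k - u k) ∂((ENNReal.ofReal (rhoW r τ γ t₀ x₀))⁻¹ • wlaw r τ t₀ x₀ γ)) -
      (if j = k then θ else 0)| ≤ ε) :
    devW r τ γ t₀ x₀ ≤ 18 * rhoW r τ γ t₀ x₀ * (ε + ε ^ 2) := by
  haveI := isFiniteMeasure_wlaw (N := N) (τ := τ) (t₀ := t₀) (x₀ := x₀) (γ := γ) hr
  set ρ := rhoW r τ γ t₀ x₀ with hρdef
  set μ := wlaw r τ t₀ x₀ γ with hμ
  set ν := (ENNReal.ofReal ρ)⁻¹ • μ with hν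
  haveI : IsProbabilityMeasure ν := isProbabilityMeasure_nlaw (τ := τ) (t₀ := t₀) (x₀ := x₀) hr hγ hρdef hρ0
  have hc : ∀ (v : V3) (i : Fin 3), |v i| ≤ ‖v‖ := fun v i => by
    rw [← Real.norm_eq_abs]; exact PiLp.norm_apply_le v i
  have hcne : (ENNReal.ofReal ρ)⁻¹ ≠ ∞ := ENNReal.inv_ne_top.2 (by rwa [Ne, ENNReal.ofReal_eq_zero, not_le])
  have hi1 : ∀ j, Integrable (fun v : V3 => v j) ν := fun j =>
    (integrable_wlaw hr hγ hR (measurable_coordV3 j) fun v hv => (hc v j).trans hv).smul_measure hcne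
  have hi2 : ∀ j k, Integrable (fun v : V3 => v j * v k) ν := fun j k => by
    have h := integrable_wlaw (τ := τ) (t₀ := t₀) (x₀ := x₀) hr hγ hR (f := fun v : V3 => v j * v k)
      ((measurable_coordV3 j).mul (measurable_coordV3 k)) (C := R * R) fun v hv => by
        rw [abs_mul]
        exact mul_le_mul ((hc v j).trans hv) ((hc v k).trans hv) (abs_nonneg _) ((norm_nonneg _).trans hv)
    exact h.smul_measure hcne
  -- moments of `ν`
  set a : Fin 3 → ℝ := fun j => ∫ v, v j ∂ν with ha
  set P : Fin 3 → Fin 3 → ℝ := fun j k => ∫ v, v j * v k ∂ν with hP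
  have hS : ∀ j k, ∫ v, (v j - u j) * (v k - u k) ∂ν = P j k - u j * a k - u k * a j + u j * u k := by
    intro j k
    have hexp : (fun v : V3 => (v j - u j) * (v k - u k)) = fun v => v j * v k - u k * v j - u j * v k + u j * u k := by
      funext v; ring
    have i1 : Integrable (fun v : V3 => v j * v k - u k * v j) ν := (hi2 j k).sub ((hi1 j).const_mul _)
    have i2 : Integrable (fun v : V3 => v j * v k - u k * v j - u j * v k) ν := i1.sub ((hi1 k).const_mul _)
    rw [hexp, integral_add i2 (integrable_const _), integral_sub i1 ((hi1 k).const_mul _),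
      integral_sub (hi2 j k) ((hi1 j).const_mul _), integral_const_mul, integral_const_mul, integral_const,
      smul_eq_mul, probReal_univ, one_mul]
    ring
  -- `C_w = ρ Cov(ν)`
  have hmunu : ∀ f : V3 → ℝ, ∫ v, f v ∂μ = ρ * ∫ v, f v ∂ν := fun f => by
    rw [hν, integral_nlaw hρ0.le, ← mul_assoc, mul_inv_cancel₀ hρ0.ne', one_mul]
  have hC : ∀ j k, CwW r τ γ t₀ x₀ j k = ρ * (P j k - a j * a k) := by
    intro j k
    unfold CwW
    rw [EwW_eq_integral hr hγ hR, mwW_eq_integral hr hγ hR, mwW_eq_integral hr hγ hR, ← hμ, hmunu, hmunu, hmunu, ← hρdef]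
    field_simp
    ring
  -- entrywise isotropy of the covariance
  have hcov : ∀ j k, |(P j k - a j * a k) - (if j = k then θ else 0)| ≤ ε + ε ^ 2 := by
    intro j k
    have e : (P j k - a j * a k) - (if j = k then θ else 0) =
        ((∫ v, (v j - u j) * (v k - u k) ∂ν) - (if j = k then θ else 0)) - (a j - u j) * (a k - u k) := by
      rw [hS]; ring
    rw [e]
    refine (abs_sub _ _).trans (add_le_add (h2 j k) ?_)
    rw [abs_mul, sq]
    exact mul_le_mul (h1 j) (h1 k) (abs_nonneg _) hε
  have hdiag : |(∑ l, (P l l - a l * a l)) / 3 - θ| ≤ ε + ε ^ 2 := by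
    have e : (∑ l, (P l l - a l * a l)) / 3 - θ = (∑ l : Fin 3, ((P l l - a l * a l) - θ)) / 3 := by
      simp only [Fin.sum_univ_three]; ring
    rw [e, abs_div, abs_of_pos (by norm_num : (0 : ℝ) < 3), div_le_iff₀ (by norm_num : (0 : ℝ) < 3)]
    calc |∑ l : Fin 3, ((P l l - a l * a l) - θ)| ≤ ∑ l : Fin 3, |(P l l - a l * a l) - θ| := Finset.abs_sum_le_sum_abs _ _
      _ ≤ ∑ _l : Fin 3, (ε + ε ^ 2) := Finset.sum_le_sum fun l _ => by simpa using hcov l l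
      _ = (ε + ε ^ 2) * 3 := by rw [Finset.sum_const, Finset.card_univ, Fintype.card_fin]; ring
  have hent : ∀ j k, |CwW r τ γ t₀ x₀ j k - if j = k then (∑ l, CwW r τ γ t₀ x₀ l l) / 3 else 0| ≤ 2 * ρ * (ε + ε ^ 2) := by
    intro j k
    have htr : (∑ l, CwW r τ γ t₀ x₀ l l) / 3 = ρ * ((∑ l, (P l l - a l * a l)) / 3) := by
      simp_rw [hC]; rw [← Finset.mul_sum]; ring
    rw [hC, htr]
    by_cases hjk : j = k
    · subst hjk
      simp only [if_true]
      have e : ρ * (P j j - a j * a j) - ρ * ((∑ l, (P l l - a l * a l)) / 3) =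
          ρ * (((P j j - a j * a j) - θ) - ((∑ l, (P l l - a l * a l)) / 3 - θ)) := by ring
      rw [e, abs_mul, abs_of_pos hρ0]
      have h' := hcov j j
      simp only [if_true] at h'
      calc ρ * |_| ≤ ρ * ((ε + ε ^ 2) + (ε + ε ^ 2)) :=
            mul_le_mul_of_nonneg_left ((abs_sub _ _).trans (add_le_add h' hdiag)) hρ0.le
        _ = _ := by ring
    · simp only [hjk, if_false, sub_zero]
      rw [abs_mul, abs_of_pos hρ0]
      have h' := hcov j k
      simp only [hjk, if_false, sub_zero] at h'
      have hε2 : 0 ≤ ε + ε ^ 2 := by positivity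
      nlinarith
  unfold devW
  calc ∑ j, ∑ k, |CwW r τ γ t₀ x₀ j k - if j = k then (∑ l, CwW r τ γ t₀ x₀ l l) / 3 else 0|
      ≤ ∑ _j : Fin 3, ∑ _k : Fin 3, 2 * ρ * (ε + ε ^ 2) := Finset.sum_le_sum fun j _ => Finset.sum_le_sum fun k _ => hent j k
    _ = 18 * ρ * (ε + ε ^ 2) := by
        simp only [Finset.sum_const, Finset.card_univ, Fintype.card_fin, nsmul_eq_mul]; push_cast; ring

end Good

/-- **Registered sub-goal `stub_wciDeviatorTrace` (helper I of `stub_windowCovarianceIsotropy`): the `ℓ¹` deviator of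
a `3 × 3` array with covariance-type entrywise bounds is at most four times its trace.** [folklore] -/
theorem stub_wciDeviatorTrace : ∀ (C : Fin 3 → Fin 3 → ℝ) (d : Fin 3 → ℝ), (∀ j, 0 ≤ d j) → (∀ j k, j ≠ k → |C j k| ≤ (d j + d k) / 2) → (∀ j, |C j j - (∑ l, d l) / 3| ≤ d j + (∑ l, d l) / 3) → ∑ l, C l l = ∑ l, d l → ∑ j, ∑ k, |C j k - if j = k then (∑ l, C l l) / 3 else 0| ≤ 4 * ∑ l, d l :=
  fun C d hd hoff hdiag htr => dev_le_four_trace C d hd hoff hdiag htr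

end Summit.AtomisticToContinuum.HydrodynamicLimit.Theorems.ParityBandClosureWindowCovariance

end
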